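import Summits.KontsevichZagierPeriods.KontsevichZagierPeriods.Theorems.MzvKernelInKZTwoPosetsTransfer
import Summits.KontsevichZagierPeriods.KontsevichZagierPeriods.Theses.FurushoPentagon

/-!
# `MzvKernelInKZ` (stmt-KontsevichZagierPeriods-3914), line two-posets-interior-landen: bridges from route `FurushoPentagon`

The calculus half of the crux `LinRedNormalForm.MzvKernelInKZ` — Hoffman's relation in every
depth, the stuffle product and the shuffle product as move chains on the canonical word
representations — is, statement for statement, the conjunction of three items of the sibling
route `FurushoPentagon`: its cruxes `HoffmanRelationInKZ` (stmt-3930) and `StuffleInKZ`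
(stmt-3931) and its support item `ShuffleIsDissection` (stmt-3932), which are stated over any
assignment `Z` agreeing with the classes of Kontsevich's simplex representations `KZ.mzvRep`.
This file proves the four bridges (registered sub-goals of the lead's skeleton
`Cruxes/MzvKernelInKZ/Lines/two-posets-interior-landen.lean`):
`HoffmanRelationInKZ → HoffmanDeepInKZ`, `HoffmanRelationInKZ → HoffmanDepthOneInKZ`,
`StuffleInKZ → StuffleProductInKZ`, `ShuffleIsDissection → ShuffleProductInKZ`, by the
assignment `Z u = zIdx u 1` (the canonical word representation of an admissible index IS the
tree's `KZ.mzvRep`, `wordRep_bword_eq_mzvRep`) and index bookkeeping. So whichever line closes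
one of those items discharges the corresponding stub of this crux.

Sources: M. E. Hoffman, Pacific J. Math. 152 (1992), Thm 5.1, and J. Algebra 194 (1997), §2;
M. Eie, *The theory of multiple zeta values with applications in combinatorics* (2013), §1.2;
M. Kontsevich, D. Zagier, *Periods* (2001), §§1.1–1.2.
-/

noncomputable section

namespace Summit.KontsevichZagierPeriods.MzvKernelInKZ.TwoPosets

open Set MeasureTheory
open Literature.NumberTheory.Transcendental
open Summit.KontsevichZagierPeriods.MzvKernelInKZ.Negative
open Summit.KontsevichZagierPeriods.KontsevichZagierPeriods.Theses.FurushoPentagon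
  (HoffmanRelationInKZ StuffleInKZ ShuffleIsDissection)

/-! ## The canonical word representation of an index is Kontsevich's simplex representation -/

/-- The canonical word representation `[Δ, ω_{bword s}]` of an admissible index equals the tree's
`KZ.mzvRep s` (same domain, same integrand function). -/
theorem wordRep_bword_eq_mzvRep (s : List ℕ) (hs : MZV.IsAdmissible s) :
    wordRep (bword (MZV.weight s) s) 1 (adm_bword hs) =
      KZ.mzvRep s hs (KZ.mzvIntegrand_isSemialgebraicFunOn_holds s)
        (KZ.mzvIntegrand_integrableOn_holds s hs) := by
  refine KZ.IntegralRep.ext' rfl ?_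
  funext t
  rw [wordRep_integrand, wordFun_one_eq_prod_mzvForm]
  rfl

/-- Hence the bracket `zIdx s 1` is the class of `KZ.mzvRep s` for admissible `s`: the
assignment `Z u = zIdx u 1` satisfies the hypothesis of the `FurushoPentagon` items. -/
theorem zIdx_one_eq_of_mzvRep (u : List ℕ) (hu : MZV.IsAdmissible u) :
    zIdx u 1 = KZ.of (KZ.mzvRep u hu (KZ.mzvIntegrand_isSemialgebraicFunOn_holds u)
      (KZ.mzvIntegrand_integrableOn_holds u hu)) := by
  rw [zIdx_of_adm hu, wordRep_bword_eq_mzvRep]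

/-! ## Index bookkeeping: `List.range` sums versus `Fin` sums -/

/-- A sum over `List.range n` of a function of the index is the `Finset` sum over `Fin n`. -/
theorem list_range_map_sum_eq_fin_sum {M : Type*} [AddCommMonoid M] (n : ℕ) (f : ℕ → M) :
    ((List.range n).map f).sum = ∑ i : Fin n, f i := by
  rw [Fin.sum_univ_eq_sum_range, ← List.sum_toFinset _ (List.nodup_range), List.toFinset_range]

/-- `s.getD i 0 = s.get ⟨i, _⟩` inside the range. -/
theorem getD_eq_get (s : List ℕ) (i : Fin s.length) : s.getD i 0 = s.get i := by
  rw [List.getD_eq_getElem _ _ i.2, List.get_eq_getElem]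

/-! ## The bridges (registered sub-goals) -/

/-- **Bridge**: route `FurushoPentagon`'s crux `HoffmanRelationInKZ` (stmt-3930) gives Hoffman's
relation in depth `≥ 2` on the canonical word representations. -/
theorem stub_hoffmanDeepOfFurusho : HoffmanRelationInKZ → HoffmanDeepInKZ := by
  intro hH s hs _
  have h := hH (fun u => zIdx u 1) (fun u hu => zIdx_one_eq_of_mzvRep u hu) s hs
  rw [list_range_map_sum_eq_fin_sum, list_range_map_sum_eq_fin_sum] at h
  simp only [list_range_map_sum_eq_fin_sum] at h
  convert h using 2
  · refine Finset.sum_congr rfl fun l _ => ?_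
    rw [getD_eq_get]
  · refine Finset.sum_congr rfl fun l _ => ?_
    rw [getD_eq_get, ← Fin.sum_univ_eq_sum_range]

/-- **Bridge**: the same crux gives the depth-one case (`s = (k)`, `k ≥ 3`). -/
theorem stub_hoffmanDepthOneOfFurusho : HoffmanRelationInKZ → HoffmanDepthOneInKZ := by
  intro hH k hk
  have hadm : MZV.IsAdmissible [k] := ⟨fun i hi => by simp at hi; omega, fun _ => by simp; omega⟩
  have h := hH (fun u => zIdx u 1) (fun u hu => zIdx_one_eq_of_mzvRep u hu) [k] hadm
  simp only [list_range_map_sum_eq_fin_sum, List.length_singleton, Fin.sum_univ_one,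
    Fin.val_zero, List.take_zero, List.nil_append, List.getD_cons_zero,
    List.drop_succ_cons, List.drop_zero, List.append_nil] at h
  rw [Finset.sum_range]
  convert h using 2
  rfl

/-- **Bridge**: route `FurushoPentagon`'s crux `StuffleInKZ` (stmt-3931) gives the stuffle product
on the canonical word representations. -/
theorem stub_stuffleProductOfFurusho : StuffleInKZ → StuffleProductInKZ := by
  intro hS s t hs ht _ _
  exact hS (fun u => zIdx u 1) (fun u hu => zIdx_one_eq_of_mzvRep u hu) s t hs ht

/-- A word of positive length with admissible letters is the binary word of an admissible index of
that weight (`MZV.ofBinaryWord`). -/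
theorem exists_index_of_adm {a : ℕ} (ha : 0 < a) (ε : Fin a → Bool) (hε : Adm ε) :
    ∃ (s : List ℕ) (_ : MZV.IsAdmissible s) (_ : MZV.weight s = a),
      MZV.binaryWord s = List.ofFn ε := by
  have h0 := (hε ha).1
  have h1 := (hε ha).2
  set w : List Bool := List.ofFn ε with hw
  have hne : w ≠ [] := by
    rw [hw, ne_eq, List.ofFn_eq_nil_iff]; omega
  have hhead : w.head? ≠ some true := by
    rw [hw, List.head?_eq_getElem?, List.getElem?_ofFn]
    simp only [ne_eq]
    rw [dif_pos ha]
    simpa using h0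
  have hlast : w.getLast? = some true := by
    rw [List.getLast?_eq_getElem?, hw, List.length_ofFn, List.getElem?_ofFn, dif_pos (by omega)]
    simpa using h1
  refine ⟨MZV.ofBinaryWord w, MZV.isAdmissible_ofBinaryWord hhead, ?_, MZV.binaryWord_ofBinaryWord hne hlast⟩
  rw [MZV.weight_ofBinaryWord hne hlast, hw, List.length_ofFn]

/-- The bracket of a shuffle of two admissible non-empty binary words, read as an index. -/
theorem zIdx_ofBinaryWord_of_mem_shuffleWord {s t : List ℕ} (hs : MZV.IsAdmissible s)
    (ht : MZV.IsAdmissible t) (hs0 : s ≠ []) (ht0 : t ≠ []) {w : List Bool}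
    (hw : w ∈ MZV.shuffleWord (MZV.binaryWord s) (MZV.binaryWord t)) :
    zIdx (MZV.ofBinaryWord w) 1 =
      zWord (MZV.weight s + MZV.weight t) (wordOf (MZV.weight s + MZV.weight t) w) 1 := by
  have hlen : w.length = MZV.weight s + MZV.weight t := by
    rw [MZV.length_of_mem_shuffleWord _ _ hw, hs.length_binaryWord, ht.length_binaryWord]
  have hne : w ≠ [] := by
    rintro rfl
    have := MZV.length_of_mem_shuffleWord _ _ hw
    rw [hs.length_binaryWord] at this
    obtain ⟨a, s', rfl⟩ := List.exists_cons_of_ne_nil hs0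
    have ha := hs.2 (List.cons_ne_nil a s')
    simp [MZV.weight] at this ha
    omega
  have hlast : w.getLast? = some true := by
    rcases MZV.getLast?_of_mem_shuffleWord _ _ hw with h | h
    · rw [h]; exact MZV.getLast?_binaryWord hs0
    · rw [h]; exact MZV.getLast?_binaryWord ht0
  rw [← zWord_bword_eq_zIdx ((MZV.weight_ofBinaryWord hne hlast).trans hlen), bword,
    MZV.binaryWord_ofBinaryWord hne hlast]

/-- **Bridge**: route `FurushoPentagon`'s support item `ShuffleIsDissection` (stmt-3932) gives the
shuffle product on the canonical word representations (any admissible letters of positive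
lengths). -/
theorem stub_shuffleProductOfFurusho : ShuffleIsDissection → ShuffleProductInKZ := by
  intro hSh a b ε ε' hε hε' ha hb
  obtain ⟨s, hs, rfl, hws⟩ := exists_index_of_adm ha ε hε
  obtain ⟨t, ht, rfl, hwt⟩ := exists_index_of_adm hb ε' hε'
  have hs0 : s ≠ [] := by rintro rfl; simp [MZV.weight] at ha
  have ht0 : t ≠ [] := by rintro rfl; simp [MZV.weight] at hb
  have h := hSh (fun u => zIdx u 1) (fun u hu => zIdx_one_eq_of_mzvRep u hu) s t hs ht
  -- identify the factors
  have es : wordRep ε 1 hε = wordRep (bword (MZV.weight s) s) 1 (adm_bword hs) := by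
    refine wordRep_congr ?_ 1 _ _
    funext i
    have := congrArg (fun L : List Bool => L.getD i false) hws
    simpa [bword, wordOf, List.getD_eq_getElem?_getD, List.getElem?_ofFn] using this.symm
  have et : wordRep ε' 1 hε' = wordRep (bword (MZV.weight t) t) 1 (adm_bword ht) := by
    refine wordRep_congr ?_ 1 _ _
    funext i
    have := congrArg (fun L : List Bool => L.getD i false) hwt
    simpa [bword, wordOf, List.getD_eq_getElem?_getD, List.getElem?_ofFn] using this.symm
  rw [es, et, ← zIdx_of_adm hs, ← zIdx_of_adm ht, ← hws, ← hwt]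
  -- identify the shuffle terms
  have hterms : ((MZV.shuffleWord (MZV.binaryWord s) (MZV.binaryWord t)).map fun w =>
      zWord (MZV.weight s + MZV.weight t) (wordOf (MZV.weight s + MZV.weight t) w) 1) =
      (MZV.shuffleWord (MZV.binaryWord s) (MZV.binaryWord t)).map fun w =>
        zIdx (MZV.ofBinaryWord w) 1 :=
    List.map_congr_left fun w hw => (zIdx_ofBinaryWord_of_mem_shuffleWord hs ht hs0 ht0 hw).symm
  rw [hterms]
  exact h

end Summit.KontsevichZagierPeriods.MzvKernelInKZ.TwoPosets
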